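import Summits.QuantumFields.YangMills.Theorems.UnitScaleTiltProp7FlatHolonomy
import Literature.MathematicalPhysics.QuantumFieldTheory.Balaban1983to89.T3Thm1CarrierNative
import Literature.MathematicalPhysics.QuantumFieldTheory.Balaban1983to89.T3SectALandauChart
import Literature.MathematicalPhysics.QuantumFieldTheory.Balaban1983to89.B12CriticalPoint23
import HarnessLib

/-!
# Route `UnitScaleTilt`, crux K1 «MinimiserStabilityRegPr» (stmt-QuantumFields-19200), registered stub `stub_prop7From14` (skeleton birth_v7
# cc37a17877262141; leaf V3 «Prop 7 from a background (14)») — **THE REGISTERED TEXT AT THE FLAT DATUM `V = 1`, FOR EVERY `ε₀`, `ε₁`**: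
# both clauses of [Balaban1985Variational] Prop 7 at the T³ carrier `T3Thm1Carrier.famX` over the trivial datum — at most one critical orbit in
# (6)(ε₀)(1) (reading R2) and a minimal orbit — PROVED (CARD-g5 «successor spec 0»)

Cell `ym3-torus` ∕ fleet seat `ym-ust-19200-p1` (gen 6).  Nothing of Bałaban's analysis is used: over `V = 1` the variational problem is rigid.
THE ARGUMENT.  A reading-R2 critical `U` over `V = 1` minimises the Wilson action over print's regular fibre (6)(e)(1) for some `e > 0`, which
contains `U ≡ 1` (`T3Thm1CarrierNative.one_mem_regFibrePr_one`), so `A(U) = A(1) = 0`; on `SU(2)` this forces every plaquette variable to be `1`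
(`Re tr W = 1 ⇒ W = 1`, `B12CriticalPoint23.eq_one_of_reTr_eq_one_specialUnitaryGroup`), hence — lattice Stokes `LatticeWordStokes.dist1_holAt_le` at
every `δ > 0`, `dist1` faithful on `SU(2)` — trivial holonomy along every word of zero net displacement (§1).  The fibre condition `D_{n,K}U = 1` says the
`(K−n)`-fold (0.4) average is `1`; for a holonomy-flat configuration that average is the straight transporter between neighbouring `(K−n)`-centres
(`Prop7FlatHolonomy.iter_blockAvg_eq_straightIter_of_flat`), so all such segments are trivial and `U = 1^{u}` with `u = 1` at the centres
(`Prop7FlatHolonomy.exists_gaugeAct_one_eq_of_segments`), i.e. `u↓ = 1`: `U` lies on the (4)-orbit of `1` (§2).  Two critical configurations are then on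
one orbit (`T3SectALandauChart.sameOrbit_symm/_trans`) — clause 1 for EVERY `ε₀` (§3); clause 2 is witnessed by `U = 1` at every radius `e > 0` (§3).
§4 packages the two clauses in the exact binder shape of the registered stub with `V := 1` (constants `a₀ = a₁′ = O₁ = 1`; the hypotheses on `ε₀`, `ε₁`,
`B₃` and the background `U₀` are not needed at the flat datum).

WHAT THIS IS NOT: not the stub (which quantifies over ALL (7)-data `V`); the flat datum is the one datum where [7] Sects. B–E are not needed.  Value: the
first kernel-checked instance of BOTH clauses of the registered text at the concrete carrier (readings R1/R2, the (0.4) averaging of record `ℰp`, print's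
group (4) via `descTransf`), and the reusable holonomy toolkit of the sibling file.

References: T. Bałaban, CMP 102 (1985) 277–309 [Balaban1985Variational] ((4)–(6) p.278, Prop. 7 p.299); CMP 109 (1987) 249–301 [Balaban1987RG1]
((0.4), (0.11) p.253); CMP 98 (1985) 17–51 [Balaban1985Averaging] ((9) p.19, (19)–(20) p.21).
-/

noncomputable section

namespace Summit.QuantumFields.YangMills.Theorems.Prop7FlatDatum

open scoped Matrix.Norms.L2Operator
open Literature.MathematicalPhysics.QuantumFieldTheory.Balaban1983to89
open T4Continuum T4ReflectionCone BlockAveraging B15DeterminingSets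
open Literature.MathematicalPhysics.QuantumFieldTheory.Balaban1983to89.T3ContinuumYM3Torus
open Literature.MathematicalPhysics.QuantumFieldTheory.Balaban1983to89.T3LevelShift
open Literature.MathematicalPhysics.QuantumFieldTheory.Balaban1983to89.T3UnitLawDensityEML (ℰp)
open Literature.MathematicalPhysics.QuantumFieldTheory.Balaban1983to89.T3TiltDescent
open Literature.MathematicalPhysics.QuantumFieldTheory.Balaban1983to89.T3ConstrainedMinimiser
open Literature.MathematicalPhysics.QuantumFieldTheory.Balaban1983to89.T3DescentFibreTower
open Literature.MathematicalPhysics.QuantumFieldTheory.Balaban1983to89.T3PrintedRegularMinimiser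
open Literature.MathematicalPhysics.QuantumFieldTheory.Balaban1983to89.T3PrintedRegularOrbits (descTransf)
open Literature.MathematicalPhysics.QuantumFieldTheory.Balaban1983to89.T3Thm1Carrier
open Literature.MathematicalPhysics.QuantumFieldTheory.Balaban1983to89.T3Thm1CarrierNative
open Literature.MathematicalPhysics.QuantumFieldTheory.Balaban1983to89.T3SectALandauChart (sameOrbit_symm sameOrbit_trans)
open Summit.QuantumFields.YangMills.Theorems.Prop7FlatHolonomy

/-! ## §1 `SU(N)`: zero Wilson action ⇒ trivial plaquettes ⇒ holonomy-flat -/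

section SUN

variable {P : Params} {j N : ℕ} [NeZero N]

/-- **`A(U) = 0 ⇒ U(∂p) = 1` on `SU(N)`**: every term `1 − Re tr U(∂p)` of the Wilson action is `≥ 0`, so all vanish, and `Re tr W = 1` only at
`W = 1`. [cite: Balaban1987RG1, (0.2) p.252] -/
theorem plaqHol_eq_one_of_wilsonAction4_eq_zero (U : GaugeField P j (Matrix.specialUnitaryGroup (Fin N) ℂ)) (hA : wilsonAction4 U = 0)
    (p : Plaq P j) : GaugeField.plaqHol U p = 1 := by
  unfold wilsonAction4 wilsonAction at hA
  have hterm : ∀ q ∈ (Finset.univ : Finset (Plaq P j)), 0 ≤ 1 * (1 - reTr (GaugeField.plaqHol U q)) := fun q _ => by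
    have := GaugeGroup.reTr_le_one (GaugeField.plaqHol U q)
    linarith
  have h0 := (Finset.sum_eq_zero_iff_of_nonneg hterm).mp hA p (Finset.mem_univ p)
  exact B12CriticalPoint23.eq_one_of_reTr_eq_one_specialUnitaryGroup _ (by linarith)

/-- On `SU(N)`, `dist1 W = ‖W − 1‖` is faithful. [cite: Balaban1985Averaging, (19) p.21] -/
theorem eq_one_of_dist1_le_zero (W : Matrix.specialUnitaryGroup (Fin N) ℂ) (h : dist1 W ≤ 0) : W = 1 := by
  have h0 : dist1 W = 0 := le_antisymm h (GaugeGroup.dist1_nonneg W)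
  have h1 : ‖(W : Matrix (Fin N) (Fin N) ℂ) - 1‖ = 0 := h0
  rw [norm_eq_zero, sub_eq_zero] at h1
  exact Subtype.ext h1

/-- **TRIVIAL PLAQUETTES ⇒ HOLONOMY-FLAT** on `SU(N)`: by the lattice Stokes bound at every `δ > 0` the holonomy along a word of zero net displacement
is within `(|w|²/4)·δ` of `1` for all `δ > 0`, hence equal to `1`. [cite: Balaban1985Averaging, (19)-(20) p.21] -/
theorem holFlat_of_plaqHol_eq_one (U : GaugeField P j (Matrix.specialUnitaryGroup (Fin N) ℂ)) (h1 : ∀ p, GaugeField.plaqHol U p = 1)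
    (x : Site P j) (w : List (Letter P.d)) (hw : ∀ ν, netDisp w ν = 0) : holAt U (walk x w) = 1 := by
  apply eq_one_of_dist1_le_zero
  refine le_of_forall_pos_le_add fun ε hε => ?_
  have hC : (0 : ℝ) ≤ (w.length : ℝ) ^ 2 / 4 := by positivity
  have hδ : 0 < ε / ((w.length : ℝ) ^ 2 / 4 + 1) := div_pos hε (by linarith)
  have hsmall : PlaqSmall (ε / ((w.length : ℝ) ^ 2 / 4 + 1)) U := fun p => by
    rw [h1 p, GaugeGroup.dist1_one]; exact hδ
  calc dist1 (holAt U (walk x w)) ≤ ((w.length : ℝ) ^ 2 / 4) * (ε / ((w.length : ℝ) ^ 2 / 4 + 1)) :=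
        LatticeWordStokes.dist1_holAt_le U hδ.le hsmall w hw x
    _ ≤ 0 + ε := by
      rw [zero_add, ← mul_div_assoc, div_le_iff₀ (by linarith)]
      nlinarith

end SUN

/-! ## §2 At the carrier: a holonomy-flat configuration in the fibre of `V = 1` lies on the (4)-orbit of `U ≡ 1` -/

section Carrier

variable (F : T3Family) {n K : ℕ} (h : n ≤ K)

/-- The fibre condition over the trivial datum, unshifted: `U ∈ fibre(1) ⇒ M^{K−n}(U) = 1` on the `K`-th tower. [cite: Balaban1987RG1, (0.11) p.253] -/
theorem iter_eq_one_of_mem_fibre_one {G : Type*} [GaugeGroup G] (ℰ : LoopAverage G) {U : GaugeField (F.P K) 0 G}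
    (hU : U ∈ fibre F ℰ n K h 1) : Averaging.iter (fun i => blockAvg (P := F.P K) (j := i) ℰ) (K - n) U = 1 := by
  have h1 : fieldShift (F.sitesPerDir_eq (m := F.m) (K := n) (j := 0) (m' := F.m) (K' := K) (j' := K - n) (by omega))
      (Averaging.iter (fun i => blockAvg (P := F.P K) (j := i) ℰ) (K - n) U) = 1 := hU
  have h2 := congrArg (fieldShift (F.sitesPerDir_eq (m := F.m) (K := n) (j := 0) (m' := F.m) (K' := K) (j' := K - n) (by omega)).symm) h1
  rw [fieldShift_fieldShift_symm] at h2
  exact h2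

/-- **HOLONOMY-FLAT + FIBRE OF `1` ⇒ ON THE ORBIT OF `1` UNDER THE GROUP (4)**: the `(K−n)`-fold average of a holonomy-flat `U` is its straight transporter
between neighbouring `(K−n)`-centres (`iter_blockAvg_eq_straightIter_of_flat`, `ℰp(1,…,1) = 1`), so `D_{n,K}U = 1` makes all these segments trivial and
`U = 1^{u}` with `u = 1` at the centres (`exists_gaugeAct_one_eq_of_segments`), i.e. `u↓ = 1`. [cite: Balaban1985Variational, (4) p.278] -/
theorem sameOrbit_one_of_flat_of_mem_fibre_one {U : GaugeField (F.P K) 0 (Matrix.specialUnitaryGroup (Fin 2) ℂ)}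
    (hflat : ∀ (x : Site (F.P K) 0) (w : List (Letter (F.P K).d)), (∀ ν, netDisp w ν = 0) → holAt U (walk x w) = 1)
    (hU : U ∈ fibre F ℰp n K h 1) : T3Thm1Carrier.SameOrbit F n K h 1 U := by
  have hk : K - n ≤ (F.P K).m + (F.P K).K := by show K - n ≤ F.m + K; omega
  have hseg : ∀ c : PBond (F.P K) (K - n),
      holAt U (walk (embIter (K - n) c.src) (List.replicate ((F.P K).L ^ (K - n)) (c.dir, true))) = 1 := fun c => by
    have h1 := congrFun (iter_eq_one_of_mem_fibre_one F h ℰp hU) c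
    rw [iter_blockAvg_eq_straightIter_of_flat ℰp expMeanLogSU_E_one U hflat (K - n)] at h1
    exact h1
  obtain ⟨u, hu1, hu⟩ := exists_gaugeAct_one_eq_of_segments U hseg hk hflat
  refine ⟨u, ?_, hu.symm⟩
  funext x
  show transfUp u (K - n) _ = 1
  rw [transfUp_eq_embIter]
  exact hu1 _

/-- **A READING-R2 CRITICAL CONFIGURATION OVER THE FLAT DATUM HAS ZERO ACTION**: it minimises over some (6)(e)(1) ∋ 1 and `A(1) = 0 ≤ A`.
[cite: Balaban1985Variational, (5)-(6) p.278] -/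
theorem wilsonAction4_eq_zero_of_isCritR2_one {U : GaugeField (F.P K) 0 (Matrix.specialUnitaryGroup (Fin 2) ℂ)} (hc : IsCritR2 F n K h 1 U) :
    wilsonAction4 U = 0 := by
  obtain ⟨e, he, -, hmin⟩ := hc
  have h1 : wilsonAction4 U ≤ wilsonAction4 (1 : GaugeField (F.P K) 0 (Matrix.specialUnitaryGroup (Fin 2) ℂ)) :=
    hmin (one_mem_regFibrePr_one F he)
  rw [wilsonAction4_one_eq_zero] at h1
  exact le_antisymm h1 (wilsonAction4_nonneg U)

/-- **EVERY READING-R2 CRITICAL CONFIGURATION OVER `V = 1` LIES ON THE (4)-ORBIT OF `U ≡ 1`.** [cite: Balaban1985Variational, Prop. 7 p.299] -/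
theorem sameOrbit_one_of_isCritR2_one {U : GaugeField (F.P K) 0 (Matrix.specialUnitaryGroup (Fin 2) ℂ)} (hc : IsCritR2 F n K h 1 U) :
    T3Thm1Carrier.SameOrbit F n K h 1 U := by
  have hfib : U ∈ fibre F ℰp n K h 1 := by
    obtain ⟨e, -, hUe, -⟩ := hc
    exact ((mem_regFibrePr_iff F).mp hUe).1
  exact sameOrbit_one_of_flat_of_mem_fibre_one F h
    (holFlat_of_plaqHol_eq_one U (plaqHol_eq_one_of_wilsonAction4_eq_zero U (wilsonAction4_eq_zero_of_isCritR2_one F h hc))) hfib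

end Carrier

/-! ## §3 The two clauses of Prop. 7 at the flat datum, for every member of the family -/

section Clauses

/-- **CLAUSE 1 OF [7] PROP. 7 AT THE FLAT DATUM, FOR EVERY `ε₀`**: over `V = 1` the variational problem (5), (6) of every member of the T³ family has at
most one critical orbit (reading R2; print's group (4)). [cite: Balaban1985Variational, Prop. 7 p.299] -/
theorem atMostOneCriticalOrbit_one {L : ℕ} (i : Idx L) (ε₀ : ℝ) :
    (famX L i).AtMostOneCriticalOrbit ε₀ (1 : GaugeField (i.1.1.P i.1.2.1) 0 (Matrix.specialUnitaryGroup (Fin 2) ℂ)) := by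
  obtain ⟨⟨F, n, K⟩, hF, hnK⟩ := i
  intro U U' _ _ hc _ _ hc'
  exact sameOrbit_trans F hnK.le (sameOrbit_symm F hnK.le (sameOrbit_one_of_isCritR2_one F hnK.le hc))
    (sameOrbit_one_of_isCritR2_one F hnK.le hc')

/-- **CLAUSE 2 OF [7] PROP. 7 AT THE FLAT DATUM, AT EVERY RADIUS `e > 0`**: `U ≡ 1` lies in (6)(e)(1) and minimises the Wilson action there (reading R1).
[cite: Balaban1985Variational, Prop. 7 p.299] -/
theorem onMinimalOrbit_one {L : ℕ} (i : Idx L) {e : ℝ} (he : 0 < e) :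
    (famX L i).OnMinimalOrbit e (1 : GaugeField (i.1.1.P i.1.2.1) 0 (Matrix.specialUnitaryGroup (Fin 2) ℂ))
      (1 : GaugeField (i.1.1.P i.1.2.2) 0 (Matrix.specialUnitaryGroup (Fin 2) ℂ)) := by
  obtain ⟨⟨F, n, K⟩, hF, hnK⟩ := i
  refine ⟨one_mem_regFibrePr_one F he, fun W _ => ?_⟩
  show wilsonAction4 (1 : GaugeField (F.P K) 0 (Matrix.specialUnitaryGroup (Fin 2) ℂ)) ≤ wilsonAction4 W
  rw [wilsonAction4_one_eq_zero]
  exact wilsonAction4_nonneg W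

end Clauses

/-! ## §4 The registered text of `stub_prop7From14` with `V := 1` -/

section Registered

/-- **THE REGISTERED STUB `stub_prop7From14` (skeleton birth_v7 cc37a178…) SPECIALISED TO THE FLAT DATUM `V = 1`, verbatim binders** — for every block
size `L > 1` and every `B₃ > 4`, with `a₀ = a₁′ = O₁ = 1`, for every member `i`, every `ε₀`, `ε₁ > 0` and every background `U₀` in (14): clause 1 (at
most one critical orbit in (6)(ε₀)(1)) and clause 2 (a minimal orbit in (6)(O₁L³B₃ε₁)(1)).  At the flat datum none of the smallness hypotheses is
used. [cite: Balaban1985Variational, Prop. 7 p.299] -/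
theorem prop7From14_flatDatum : ∀ (L : ℕ), 1 < L → ∀ B₃ : ℝ, 4 < B₃ →
    ∃ a₀ a₁' O₁ : ℝ, 0 < a₀ ∧ 0 < a₁' ∧ 1 ≤ O₁ ∧ ∀ (i : Idx L) (ε₀ ε₁ : ℝ), 0 < ε₁ →
      (famX L i).Reg7 ε₁ (1 : GaugeField (i.1.1.P i.1.2.1) 0 (Matrix.specialUnitaryGroup (Fin 2) ℂ)) →
      ∀ U₀ : (famX L i).Cfg, (famX L i).InU ((L : ℝ) ^ 3 * B₃ * ε₁) U₀ →
        (famX L i).InB (1 : GaugeField (i.1.1.P i.1.2.1) 0 (Matrix.specialUnitaryGroup (Fin 2) ℂ)) U₀ →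
        (ε₀ ≤ a₀ → B₃ * ε₁ ≤ ε₀ →
          (famX L i).AtMostOneCriticalOrbit ε₀ (1 : GaugeField (i.1.1.P i.1.2.1) 0 (Matrix.specialUnitaryGroup (Fin 2) ℂ))) ∧
        (ε₁ ≤ a₁' → ∃ U : (famX L i).Cfg,
          (famX L i).OnMinimalOrbit (O₁ * (L : ℝ) ^ 3 * B₃ * ε₁)
            (1 : GaugeField (i.1.1.P i.1.2.1) 0 (Matrix.specialUnitaryGroup (Fin 2) ℂ)) U) := by
  intro L hL B₃ hB₃
  refine ⟨1, 1, 1, one_pos, one_pos, le_rfl, fun i ε₀ ε₁ hε₁ _ U₀ _ _ => ⟨fun _ _ => atMostOneCriticalOrbit_one i ε₀, fun _ => ?_⟩⟩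
  have he : 0 < 1 * (L : ℝ) ^ 3 * B₃ * ε₁ := by
    have hL0 : (0 : ℝ) < L := by exact_mod_cast (zero_lt_one.trans hL)
    have hB : (0 : ℝ) < B₃ := by linarith
    positivity
  exact ⟨_, onMinimalOrbit_one i he⟩

/-- The same without the idle hypotheses: **both clauses at the flat datum for every member, every `ε₀` and every radius `e > 0`**.
[cite: Balaban1985Variational, Prop. 7 p.299] -/
theorem prop7_clauses_flatDatum {L : ℕ} (i : Idx L) (ε₀ e : ℝ) (he : 0 < e) :
    (famX L i).AtMostOneCriticalOrbit ε₀ (1 : GaugeField (i.1.1.P i.1.2.1) 0 (Matrix.specialUnitaryGroup (Fin 2) ℂ)) ∧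
      ∃ U : (famX L i).Cfg, (famX L i).OnMinimalOrbit e (1 : GaugeField (i.1.1.P i.1.2.1) 0 (Matrix.specialUnitaryGroup (Fin 2) ℂ)) U :=
  ⟨atMostOneCriticalOrbit_one i ε₀, _, onMinimalOrbit_one i he⟩

end Registered

end Summit.QuantumFields.YangMills.Theorems.Prop7FlatDatum

end
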